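import Summits.QuantumFields.YangMills.Theorems.RevelationMartingaleMeanDeviationBoundedDepth
import Summits.QuantumFields.YangMills.Theses.RevelationMartingale
import HarnessLib

/-!
# Route RevelationMartingale on crux `HistoryTailL` (stmt-QuantumFields-19936) — GLUE: the centring cruxes `MeanDeviationL` (stmt-23083),
# `MeanDeviationShallowL` (stmt-23133), `MeanDeviationDeepL` (stmt-23134) FROM THE UNIFORM PER-PLAQUETTE AVERAGED-TAIL SCHEMA

Cell `ym3-torus` (YM ladder rung R3 = continuum SU(2) Yang–Mills on the three-torus — a RUNG, NOT the Clay problem: not d = 4, not infinite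
volume, not a mass gap), width seat `ym-ust-19936-w3` gen 9.  The registered line «revelation_martingale» v3 on the crux carries the two centring
stubs `stub_meanDeviationShallow : MeanDeviationShallowL` and `stub_meanDeviationDeep : MeanDeviationDeepL` (children of `MeanDeviationL`, glue
✓ `RevelationMartingaleMeanDeviationSplit`).  The LEAD's census (card `Lines/birth_v5p10.md` v1.18–1.19 (c)) locates the all-depth first-moment bound in
the renormalisation-group organ: elementary tools reach bounded depth (✓ `RevelationMartingaleMeanDeviationBoundedDepth`, gen 8) and logarithmic depth
(✓ `RevelationMartingaleMeanDeviationLogDepth`, this seat) only.  THIS FILE is the DOOR through which the organ's output closes all three cruxes: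

* ★ `meanDeviationL_of_perPlaquette_uniform` — if for every `L` and every profile `b₀ > 0`, `p₀ > 2` there are `γ₁ > 0`, `C ≥ 0`, `c > 0`, `A`
  such that for every family `F` (`F.L = L`), `0 < γ ≤ γ₁`, `1 ≤ j ≤ K` and plaquette `p` of `T^{(j)}`:
  `Gibbs_K{θ(b₀)(K−j) ≤ |Ū^j(∂p) − 1|} ≤ C·β_{K−j}^A·exp(−c·p(g_{K−j})²)` — the cell's UNIFORM PER-PLAQUETTE SCHEMA (the hypothesis letters of
  lit ✓ `T3AveragedTailProfile.averagedTailAt_of_perPlaquette`, constants fixed BEFORE the family) — then `MeanDeviationL` holds BY NAME: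
  layer cake `E f ≤ a + 2μ{a ≤ f}` at `a = θ(b₀/4) = θ(b₀)/4` and the decay `C·g^{−2A}·e^{−c·p(b₀/4; g)²} ≤ C·g² ≤ g·p(g)/8` for `g ≤ g_*`
  (gen 8's `integral_le_add_mul_measureReal_ge'` and `exists_exp_neg_mul_pFun_sq_le_pow`).
* `meanDeviationShallowL_of_meanDeviationL` (`N₁ := 1`), `meanDeviationDeepL_of_meanDeviationL` — the parent ⇒ children faces, so that ONE schema
  supplier closes 23083, 23133, 23134 and both centring stubs of the line by `exact`.

HONEST.  Glue only — zero analytic content beyond gen 8's letters; the schema hypothesis is NOT supplied here (it is the located open content: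
[Balaban1985UV3] (71) summed K-uniformly, unprinted).  Nothing of `MeanDeviationL`, `SubGaussianRevelationL`, the crux `HistoryTailL`, the rung
R3, d = 4, a continuum limit or a mass gap is proved.  YM₃ on T³ is rung R3, NOT the Clay problem.

References: T. Bałaban, CMP **102** (1985) 255–275 [Balaban1985UV3] ((7) p.257 thresholds; (71) p.273 the per-plaquette factors).
-/

noncomputable section

open MeasureTheory
open Literature.MathematicalPhysics.QuantumFieldTheory.Balaban1983to89
open Literature.MathematicalPhysics.QuantumFieldTheory.Balaban1983to89.T3ContinuumYM3Torus
open Literature.MathematicalPhysics.QuantumFieldTheory.Balaban1983to89.T3UnitScaleTilt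
open Literature.MathematicalPhysics.QuantumFieldTheory.Balaban1983to89.T3UnitLawDensityEML (ℰp)
open Literature.MathematicalPhysics.QuantumFieldTheory.Balaban1983to89.B10LargeField (xlog pFun_eq one_le_xlog)
open Literature.MathematicalPhysics.QuantumFieldTheory.Balaban1983to89.T3UpperLiftSplit (scheme_β_eq)
open Summit.QuantumFields.YangMills.Theorems.CovariantDischargeDirectionNet (dist1_le_two)
open Summit.QuantumFields.YangMills.Theorems.RevelationMartingaleMeanDeviationBoundedDepth
  (integral_le_add_mul_measureReal_ge' exists_exp_neg_mul_pFun_sq_le_pow)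

namespace Summit.QuantumFields.YangMills.Theorems.RevelationMartingaleMeanDeviationOfPerPlaquetteTail

/-! ## §1 `MeanDeviationL` from the uniform per-plaquette schema -/

/-- **THE CENTRING CRUX FROM THE UNIFORM PER-PLAQUETTE AVERAGED-TAIL SCHEMA.**  If for every `L` and profile `b₀ > 0`, `p₀ > 2` there are
`γ₁ > 0`, `C ≥ 0`, `c > 0`, `A : ℕ` with `Gibbs_K{θ(b₀)(K−j) ≤ |Ū^j(∂p) − 1|} ≤ C·β_{K−j}^A·exp(−c·p(g_{K−j})²)` for every family `F` with
`F.L = L`, every `0 < γ ≤ γ₁`, every `1 ≤ j ≤ K` and every plaquette `p` of `T^{(j)}`, then `MeanDeviationL` (stmt-QuantumFields-23083):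
`∫ dist1(Ū^j(∂p)) d(gibbsK K) ≤ ½θ(b₀)(K−j)` for `γ ≤ γ₁'(L, b₀, p₀)`.  Layer cake at `θ(b₀/4)` + the decay `e^{−c·p²} ≤ g^{2A+2}`.
[cite: Balaban1985UV3, (7) p.257 and (71) p.273] -/
theorem meanDeviationL_of_perPlaquette_uniform
    (h : ∀ (L : ℕ) (b₀ p₀ : ℝ), 0 < b₀ → 2 < p₀ → ∃ (γ₁ C c : ℝ) (A : ℕ), 0 < γ₁ ∧ 0 ≤ C ∧ 0 < c ∧
      ∀ (F : T3Family) (γ : ℝ), F.L = L → 0 < γ → γ ≤ γ₁ → ∀ (K j : ℕ), 1 ≤ j → j ≤ K → ∀ p : Plaq (F.P K) j,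
        (gibbsK F ℰp γ K).real
            {U | θBal F.L γ b₀ p₀ (K - j) ≤
              GaugeGroup.dist1 (GaugeField.plaqHol
                (Averaging.iter (fun i => BlockAveraging.blockAvg (P := F.P K) (j := i) ℰp) j U) p)} ≤
          C * (F.scheme ℰp γ).β (K - j) ^ A *
            Real.exp (-(c * B10.pFun b₀ p₀ (Real.sqrt (γ * ((F.L : ℝ)⁻¹) ^ (K - j))) ^ 2))) :
    Summit.QuantumFields.YangMills.Theses.RevelationMartingale.MeanDeviationL := by
  intro L b₀ p₀ hb₀ hp₀
  -- the schema at the profile `b₀/4`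
  obtain ⟨γ₁, C, c, A, hγ₁, hC, hc, htail⟩ := h L (b₀ / 4) p₀ (by positivity) hp₀
  -- decay at the profile `b₀/4`: `e^{−c·p(b₀/4; g)²} ≤ g^{2A+2}`
  obtain ⟨gs, hgs, hgs1, hdec⟩ :=
    exists_exp_neg_mul_pFun_sq_le_pow (c := c) (b₀ := b₀ / 4) (p₀ := p₀) hc (by positivity) (by linarith) (2 * A + 2)
  -- the coupling threshold: `g ≤ gs` and `g ≤ b₀/(16(C+1))`
  set g₁ : ℝ := min gs (b₀ / (16 * (C + 1))) with hg₁_def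
  have hg₁ : 0 < g₁ := lt_min hgs (by positivity)
  refine ⟨min γ₁ (min 1 (g₁ ^ 2)), lt_min hγ₁ (lt_min one_pos (pow_pos hg₁ 2)), (min_le_right _ _).trans (min_le_left _ _), ?_⟩
  intro F γ hFL hγ hγ1 K j hj1 hjK p
  have hγγ₁ : γ ≤ γ₁ := hγ1.trans (min_le_left _ _)
  have hγone : γ ≤ 1 := hγ1.trans ((min_le_right _ _).trans (min_le_left _ _))
  have hγg₁ : γ ≤ g₁ ^ 2 := hγ1.trans ((min_le_right _ _).trans (min_le_right _ _))
  have hL1 : 1 ≤ F.L := F.hL.2.le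
  have hLpos : (0 : ℝ) < F.L := by exact_mod_cast (zero_lt_one.trans_le hL1)
  haveI := isProbabilityMeasure_gibbsK F ℰp hγ.le K
  -- the coupling `g = g_{K−j} = √(γ L^{−(K−j)})`
  have hq0 : 0 < γ * ((F.L : ℝ)⁻¹) ^ (K - j) := mul_pos hγ (pow_pos (inv_pos.mpr hLpos) _)
  have hq1 : γ * ((F.L : ℝ)⁻¹) ^ (K - j) ≤ γ := by
    have : ((F.L : ℝ)⁻¹) ^ (K - j) ≤ 1 :=
      pow_le_one₀ (inv_nonneg.mpr hLpos.le) (inv_le_one_of_one_le₀ (by exact_mod_cast hL1))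
    simpa using mul_le_mul_of_nonneg_left this hγ.le
  obtain ⟨g, hg_def⟩ : ∃ g : ℝ, g = Real.sqrt (γ * ((F.L : ℝ)⁻¹) ^ (K - j)) := ⟨_, rfl⟩
  have hg0 : 0 < g := by rw [hg_def]; exact Real.sqrt_pos.mpr hq0
  have hg_sq : g ^ 2 = γ * ((F.L : ℝ)⁻¹) ^ (K - j) := by rw [hg_def, Real.sq_sqrt hq0.le]
  have hgg₁ : g ≤ g₁ := by
    have h1 : γ * ((F.L : ℝ)⁻¹) ^ (K - j) ≤ g₁ ^ 2 := hq1.trans hγg₁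
    rw [hg_def]
    exact (Real.sqrt_le_sqrt h1).trans_eq (Real.sqrt_sq hg₁.le)
  have hggs : g ≤ gs := hgg₁.trans (min_le_left _ _)
  have hgb : g ≤ b₀ / (16 * (C + 1)) := hgg₁.trans (min_le_right _ _)
  have hg1' : g ≤ 1 := hggs.trans hgs1
  -- thresholds: `θ(b₀) = g·p(g)`, `θ(b₀/4) = g·p(g)/4`, `p(g) ≥ b₀`
  set P : ℝ := B10.pFun b₀ p₀ g with hP_def
  have hθ : θBal F.L γ b₀ p₀ (K - j) = g * P := by rw [hP_def, hg_def]; rfl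
  have hθ4 : θBal F.L γ (b₀ / 4) p₀ (K - j) = g * P / 4 := by
    rw [show b₀ / 4 = (1 / 4 : ℝ) * b₀ by ring, T3InteriorExcision.θBal_mul, hθ]; ring
  have hPb : b₀ ≤ P := by
    rw [hP_def, pFun_eq]
    have hx1 := one_le_xlog hg0 hg1'
    have : (1 : ℝ) ≤ xlog g ^ p₀ := Real.one_le_rpow hx1 (by linarith)
    nlinarith
  -- layer cake at `a = θ(b₀/4)`
  have hf0 : ∀ U : GaugeField (F.P K) 0 (Matrix.specialUnitaryGroup (Fin 2) ℂ), 0 ≤ GaugeGroup.dist1 (GaugeField.plaqHol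
      (Averaging.iter (fun i => BlockAveraging.blockAvg (P := F.P K) (j := i) ℰp) j U) p) := fun U => GaugeGroup.dist1_nonneg _
  have hf2 : ∀ U : GaugeField (F.P K) 0 (Matrix.specialUnitaryGroup (Fin 2) ℂ), GaugeGroup.dist1 (GaugeField.plaqHol
      (Averaging.iter (fun i => BlockAveraging.blockAvg (P := F.P K) (j := i) ℰp) j U) p) ≤ 2 := fun U => dist1_le_two _
  have ha : 0 ≤ θBal F.L γ (b₀ / 4) p₀ (K - j) := by
    rw [hθ4]; exact div_nonneg (mul_nonneg hg0.le (hb₀.le.trans hPb)) (by norm_num)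
  have hlayer := integral_le_add_mul_measureReal_ge' (μ := gibbsK F ℰp γ K) ha zero_le_two hf0 hf2
  -- the schema at the profile `b₀/4` and the decay `C·g^{−2A}·e^{−c p(b₀/4)²} ≤ C·g²`
  have ht := htail F γ hFL hγ hγγ₁ K j hj1 hjK p
  have hβ : (F.scheme ℰp γ).β (K - j) = (g ^ 2)⁻¹ := by rw [hg_sq]; rfl
  rw [hβ, ← hg_def] at ht
  have hdec' := hdec g hg0 hggs
  have hmain : 2 * (C * (g ^ 2)⁻¹ ^ A * Real.exp (-(c * B10.pFun (b₀ / 4) p₀ g ^ 2))) ≤ g * P / 4 := by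
    have h1 : C * (g ^ 2)⁻¹ ^ A * Real.exp (-(c * B10.pFun (b₀ / 4) p₀ g ^ 2)) ≤ C * (g ^ 2)⁻¹ ^ A * g ^ (2 * A + 2) :=
      mul_le_mul_of_nonneg_left hdec' (by positivity)
    have h2 : C * (g ^ 2)⁻¹ ^ A * g ^ (2 * A + 2) = C * g ^ 2 := by
      have hg2 : (g ^ 2) ^ A ≠ 0 := pow_ne_zero _ (pow_ne_zero 2 hg0.ne')
      rw [pow_add, pow_mul, inv_pow]
      field_simp
    have h4 : 16 * (C + 1) * g ≤ b₀ := by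
      have := mul_le_mul_of_nonneg_left hgb (by positivity : (0 : ℝ) ≤ 16 * (C + 1))
      rwa [mul_div_cancel₀ _ (by positivity : (16 : ℝ) * (C + 1) ≠ 0)] at this
    have h3 : 2 * (C * g ^ 2) ≤ g * P / 4 := by nlinarith [hg0.le, hC, hPb]
    linarith [h1, h2.le, h2.ge]
  calc ∫ U, GaugeGroup.dist1 (GaugeField.plaqHol
          (Averaging.iter (fun i => BlockAveraging.blockAvg (P := F.P K) (j := i) ℰp) j U) p) ∂(gibbsK F ℰp γ K)
      ≤ θBal F.L γ (b₀ / 4) p₀ (K - j) + 2 * (gibbsK F ℰp γ K).real {U | θBal F.L γ (b₀ / 4) p₀ (K - j) ≤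
          GaugeGroup.dist1 (GaugeField.plaqHol
            (Averaging.iter (fun i => BlockAveraging.blockAvg (P := F.P K) (j := i) ℰp) j U) p)} := hlayer
    _ ≤ g * P / 4 + g * P / 4 := add_le_add hθ4.le ((mul_le_mul_of_nonneg_left ht zero_le_two).trans hmain)
    _ = θBal F.L γ b₀ p₀ (K - j) / 2 := by rw [hθ]; ring

/-! ## §2 The parent ⇒ children faces of the depth split -/

/-- `MeanDeviationL ⇒ MeanDeviationShallowL` (take `N₁ := 1`; stmt-QuantumFields-23133 from 23083). [folklore] -/
theorem meanDeviationShallowL_of_meanDeviationL (h : Summit.QuantumFields.YangMills.Theses.RevelationMartingale.MeanDeviationL) :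
    Summit.QuantumFields.YangMills.Theses.RevelationMartingale.MeanDeviationShallowL := by
  intro L
  refine ⟨1, one_pos, fun b₀ p₀ hb₀ hp₀ => ?_⟩
  obtain ⟨γ₁, hγ₁, hγ₁1, hF⟩ := h L b₀ p₀ hb₀ hp₀
  exact ⟨γ₁, hγ₁, hγ₁1, fun F γ hFL hγ hγ1 K j hj hjK p => hF F γ hFL hγ hγ1 K j hj (by omega) p⟩

/-- `MeanDeviationL ⇒ MeanDeviationDeepL` (stmt-QuantumFields-23134 from 23083; the depth-fraction condition is discarded). [folklore] -/
theorem meanDeviationDeepL_of_meanDeviationL (h : Summit.QuantumFields.YangMills.Theses.RevelationMartingale.MeanDeviationL) :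
    Summit.QuantumFields.YangMills.Theses.RevelationMartingale.MeanDeviationDeepL := by
  intro L N₁ _ b₀ p₀ hb₀ hp₀
  obtain ⟨γ₁, hγ₁, hγ₁1, hF⟩ := h L b₀ p₀ hb₀ hp₀
  exact ⟨γ₁, hγ₁, hγ₁1, fun F γ hFL hγ hγ1 K j hj hjK _ p => hF F γ hFL hγ hγ1 K j hj hjK p⟩

/-- **ALL THREE CENTRING CRUXES FROM THE UNIFORM PER-PLAQUETTE SCHEMA** (23083 ∧ 23133 ∧ 23134). [cite: Balaban1985UV3, (7) p.257 and (71) p.273] -/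
theorem meanDeviation_all_of_perPlaquette_uniform
    (h : ∀ (L : ℕ) (b₀ p₀ : ℝ), 0 < b₀ → 2 < p₀ → ∃ (γ₁ C c : ℝ) (A : ℕ), 0 < γ₁ ∧ 0 ≤ C ∧ 0 < c ∧
      ∀ (F : T3Family) (γ : ℝ), F.L = L → 0 < γ → γ ≤ γ₁ → ∀ (K j : ℕ), 1 ≤ j → j ≤ K → ∀ p : Plaq (F.P K) j,
        (gibbsK F ℰp γ K).real
            {U | θBal F.L γ b₀ p₀ (K - j) ≤
              GaugeGroup.dist1 (GaugeField.plaqHol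
                (Averaging.iter (fun i => BlockAveraging.blockAvg (P := F.P K) (j := i) ℰp) j U) p)} ≤
          C * (F.scheme ℰp γ).β (K - j) ^ A *
            Real.exp (-(c * B10.pFun b₀ p₀ (Real.sqrt (γ * ((F.L : ℝ)⁻¹) ^ (K - j))) ^ 2))) :
    Summit.QuantumFields.YangMills.Theses.RevelationMartingale.MeanDeviationL ∧
      Summit.QuantumFields.YangMills.Theses.RevelationMartingale.MeanDeviationShallowL ∧
        Summit.QuantumFields.YangMills.Theses.RevelationMartingale.MeanDeviationDeepL :=
  have hM := meanDeviationL_of_perPlaquette_uniform h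
  ⟨hM, meanDeviationShallowL_of_meanDeviationL hM, meanDeviationDeepL_of_meanDeviationL hM⟩

end Summit.QuantumFields.YangMills.Theorems.RevelationMartingaleMeanDeviationOfPerPlaquetteTail

end
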